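import Summits.HodgeConjecture.HodgeConjecture.Theorems.R90S2ArchLocalTorusTransport      -- ★ FILE 3a (mine): local stable-centraliser isos, `archCentralizerPiEquiv`, global = ∏ local transport
import Summits.HodgeConjecture.HodgeConjecture.Theorems.R90S2ArchProductMeasureFamily    -- ★ FILE 2 (mine): `archQuotPiEquiv`
import Summits.HodgeConjecture.HodgeConjecture.Theorems.R90S2ArchHaarProduct             -- ★ CARD 6: `exists_pi_eq_map_of_isHaarMeasure`
import Literature.NumberTheory.Automorphic.UnitaryGroupArchTopology                     -- ★ instances `LocallyCompactSpace ∕ SecondCountableTopology ∕ T2Space` on `arch …`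
import Literature.NumberTheory.Automorphic.LocalOrbitalMeasure                          -- ★ `isMulRightInvariant_of_forall_comm`, `isClosed_coe_centralizer_singleton`
import Literature.NumberTheory.Automorphic.UnitaryGroupOfLocalTorusMeasure              -- ★ `isInvInvariant_of_isMulRightInvariant_of_isClosed`
import Literature.NumberTheory.Automorphic.ArchLocalRegularOrbitClosed                  -- ★ `locallyCompactSpace_archLocal`, `secondCountableTopology_archLocal`
import HarnessLib

/-!
# R90-TF ∕ S2 «Ch. 12 archimedean block» — `R90S2ArchLocalWeilFamilies`: the local torus measures BY TRANSPORT and the local WEIL families of `U(σ_w H)(ℂ)`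
# (orbital-product road FILE 3b; consumed by FILE 3c `R90S2ArchProductFamilyOfQuotient`)

Cell `pub/hodgecm-mathlib`, HCML Track R90-TF, section S2 (base `R90-C11`), crux h413 = `stmt-HodgeConjecture-24833`, route of record `HCCMUnconditional`; prover seat
LH4-p05 (g11) (S2 desk K2E1b-plan (g8) deal 2026-09-05T02:23:15Z (4), census «=» 02:38:26Z); lane `--supports stmt-HodgeConjecture-24833 --as helper`
(`--kind definition`: three measure-valued `def`s).  Conventions of ★ FILE 1: no socket, no instance, no notation, no `sorry`, default heartbeats.

## WHAT (print's «compatible measures» §1.7 ∕ §4.3 at ONE complex place, and the Haar bookkeeping on `Z(γ) ≅ ∏_w Z(γ_w)`)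
* §4 `centralizer_comm_of_isRegularElt_archLocal`, `isInvInvariant_of_isHaarMeasure_centralizer_archLocal` — the torus of a regular `δ ∈ U(σ_w H)(ℂ)` is
  commutative, so every Haar measure on it is inversion-invariant (★ `isMulRightInvariant_of_forall_comm`, ★ `isInvInvariant_of_isMulRightInvariant_of_isClosed`).
* §5 `archLocTorusMeasure hH h₀ τ₀ δ` — on the stable class of a regular base point `δ₀`, the transport `(Z(δ₀) ≃ₜ* Z(δ))_* τ₀` of ONE Haar measure `τ₀` along ★ FILE 3a
  `archLocalStableCentralizerEquiv` (junk `0` off the class): Haar, inversion-invariant, and (C_w)-COHERENT under conjugation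
  (`map_subgroupCongrHomeomorph_conj_archLocTorusMeasure`, from ★ FILE 3a's cocycle law) — Shelstad's «the pair `dt′, ψ_x` defines `dt` independently of `x`»;
  `archLocWeilPoint` ∕ `archLocWeilFamily` — the local WEIL family `c ↦ dνw ∕ dτ(out c)` (★ `quotientMeasure`) on the class, junk `0` off it; `_of_pos` ∕ `_of_not`,
  `archLocWeilFamily_isQuotientOf` (★ `OrbitalMeasureFamily.IsQuotientOf` certificate), `smulInvariantMeasure_…` ∕ `isFiniteMeasureOnCompacts_…` (EVERY member — ★ FILE 2
  MAIN's binders), `archLocWeilFamily_atPoint` (read at a point `δ` of the class it IS `dνw ∕ dτ(δ)`, ★ generic `atPoint_eq_quotientMeasure_of_forall_map_conj_eq`).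
* §6 `exists_pi_eq_map_archCentralizerPiEquiv` (a Haar measure on `Z(γ)` is `⊗_w τ⁰_w` along ★ FILE 3a `archCentralizerPiEquiv`, one factor rescaled — ★ CARD 6
  `exists_pi_eq_map_of_isHaarMeasure`), `map_archQuotPiEquiv_eq` (★ FILE 2 `archQuotPiEquiv` as the push-forward along ★ `cosetCongr e` then ★ `quotientPiHomeomorph`).

HONEST LABEL: measure-theoretic plumbing; pays no printed input; HC_CM is proved only modulo the 7 printed citations (2 remaining named inputs: hLiu418 =
`stmt-HodgeConjecture-24832`, h413 = `stmt-HodgeConjecture-24833`) until rung 0 closes.  Count-neutral.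

References: [Rogawski1990] §1.7 p. 6, §4.3 (4.3.1) pp. 43–44; [Shelstad1979] §4 p. 20; [DeitmarEchterhoff2014] Thm. 1.5.3; [Folland1995] §2.2 Thm. 2.20, Thm. 2.49.
-/

set_option autoImplicit false
set_option linter.dupNamespace false  -- the route namespace `Summit.HodgeConjecture.HodgeConjecture.…` repeats a component by design (as ★ FILE 1)

noncomputable section

open MeasureTheory NumberField NumberField.InfinitePlace
open scoped Matrix MatrixGroups Classical
open Literature.NumberTheory.Automorphic Literature.NumberTheory.Automorphic.UnitaryGroup
open Literature.NumberTheory.Rogawski1990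
open Literature.LinearAlgebra.Matrix
open Literature.MeasureTheory.Group

namespace Summit.HodgeConjecture.HodgeConjecture.R90.S2

/-! ## §4 Inversion-invariance transports; Haar measures on the local tori -/

section HaarLocal

variable {L : Type} [Field L] {N : ℕ} (H : Matrix (Fin N) (Fin N) L) {w : {w : InfinitePlace L // w.IsComplex}}
  [MeasurableSpace ↥(archLocal L N H w)] [BorelSpace ↥(archLocal L N H w)]

omit [MeasurableSpace ↥(archLocal L N H w)] [BorelSpace ↥(archLocal L N H w)] in
/-- The centraliser of a regular `δ ∈ U(σ_w H)(ℂ)` is commutative (its `GL_N(ℂ)`-commutant is). [cite: Rogawski1990, §3.1 p. 19] -/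
theorem centralizer_comm_of_isRegularElt_archLocal (δ : ↥(archLocal L N H w)) (hδ : IsRegularElt (δ : GL (Fin N) ℂ)) :
    ∀ a ∈ Subgroup.centralizer ({δ} : Set ↥(archLocal L N H w)), ∀ b ∈ Subgroup.centralizer ({δ} : Set ↥(archLocal L N H w)), a * b = b * a := by
  intro a ha b hb
  have ha' : Commute ((a : GL (Fin N) ℂ) : Matrix (Fin N) (Fin N) ℂ) ((δ : GL (Fin N) ℂ) : Matrix (Fin N) (Fin N) ℂ) :=
    congrArg (fun g : ↥(archLocal L N H w) => ((g : GL (Fin N) ℂ) : Matrix (Fin N) (Fin N) ℂ)) (Subgroup.mem_centralizer_singleton_iff.mp ha)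
  have hb' : Commute ((b : GL (Fin N) ℂ) : Matrix (Fin N) (Fin N) ℂ) ((δ : GL (Fin N) ℂ) : Matrix (Fin N) (Fin N) ℂ) :=
    congrArg (fun g : ↥(archLocal L N H w) => ((g : GL (Fin N) ℂ) : Matrix (Fin N) (Fin N) ℂ)) (Subgroup.mem_centralizer_singleton_iff.mp hb)
  have h := commute_of_commute_of_isRegularElt_archLocal H δ hδ _ _ ha' hb'
  exact Subtype.ext (Units.ext h.eq)

/-- **Every Haar measure on the torus `Z(δ)` of a regular `δ ∈ U(σ_w H)(ℂ)` is inversion-invariant** (the torus is commutative, hence unimodular: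
★ `isMulRightInvariant_of_forall_comm`, ★ `isInvInvariant_of_isMulRightInvariant_of_isClosed`). [cite: Folland1995, Thm. 2.49] [cite: DeitmarEchterhoff2014, Thm. 1.5.3] -/
theorem isInvInvariant_of_isHaarMeasure_centralizer_archLocal (δ : ↥(archLocal L N H w)) (hδ : IsRegularElt (δ : GL (Fin N) ℂ))
    (μ : Measure (Subgroup.centralizer ({δ} : Set ↥(archLocal L N H w)))) [μ.IsHaarMeasure] : μ.IsInvInvariant := by
  haveI := locallyCompactSpace_archLocal L N H w
  haveI := secondCountableTopology_archLocal L N H w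
  haveI := isMulRightInvariant_of_forall_comm (Subgroup.centralizer ({δ} : Set ↥(archLocal L N H w))) (isClosed_coe_centralizer_singleton δ)
    (centralizer_comm_of_isRegularElt_archLocal H δ hδ) μ
  exact isInvInvariant_of_isMulRightInvariant_of_isClosed (Subgroup.centralizer ({δ} : Set ↥(archLocal L N H w)))
    (isClosed_coe_centralizer_singleton δ) μ

/-! ## §5 The local torus measures by transport from a base point, and the local Weil families -/

variable (hH : H.det ≠ 0) {δ₀ : ↥(archLocal L N H w)} (h₀ : IsRegularElt (δ₀ : GL (Fin N) ℂ))
  (τ₀ : Measure (Subgroup.centralizer ({δ₀} : Set ↥(archLocal L N H w))))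

/-- **THE LOCAL TORUS MEASURES BY TRANSPORT**: on the stable class of the regular base point `δ₀ ∈ U(σ_w H)(ℂ)`, `τ(δ) := (Z(δ₀) ≃ₜ* Z(δ))_* τ₀` (★ FILE 3a
`archLocalStableCentralizerEquiv`); junk `0` off the stable class (never read).  Print: «the pair `dt′, ψ_x` defines a measure `dt` on `T`, independently of the
choice of `x`» — compatible torus measures at one place. [cite: Shelstad1979, §4 p. 20] [cite: Rogawski1990, §1.7 p. 6; §4.3 p. 43] -/
def archLocTorusMeasure (δ : ↥(archLocal L N H w)) : Measure (Subgroup.centralizer ({δ} : Set ↥(archLocal L N H w))) :=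
  if h : IsStablyConj (starRingEnd ℂ) (H.map w.1.embedding) δ₀ δ then τ₀.map (archLocalStableCentralizerEquiv H hH h h₀) else 0

omit [BorelSpace ↥(archLocal L N H w)] in
/-- On the stable class: `archLocTorusMeasure δ = (ψ_{δ₀→δ})_* τ₀`. [cite: Shelstad1979, §4 p. 20] -/
theorem archLocTorusMeasure_eq_map {δ : ↥(archLocal L N H w)} (h : IsStablyConj (starRingEnd ℂ) (H.map w.1.embedding) δ₀ δ) :
    archLocTorusMeasure H hH h₀ τ₀ δ = τ₀.map (archLocalStableCentralizerEquiv H hH h h₀) := by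
  rw [archLocTorusMeasure, dif_pos h]

/-- The transported torus measure is a Haar measure. [cite: Folland1995, §2.2 (2.20)] -/
theorem isHaarMeasure_archLocTorusMeasure [τ₀.IsHaarMeasure] {δ : ↥(archLocal L N H w)} (h : IsStablyConj (starRingEnd ℂ) (H.map w.1.embedding) δ₀ δ) :
    (archLocTorusMeasure H hH h₀ τ₀ δ).IsHaarMeasure := by
  rw [archLocTorusMeasure_eq_map H hH h₀ τ₀ h]
  exact ContinuousMulEquiv.isHaarMeasure_map τ₀ _

/-- The transported torus measure is inversion-invariant (the target torus is commutative). [cite: DeitmarEchterhoff2014, Thm. 1.5.3] -/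
theorem isInvInvariant_archLocTorusMeasure [τ₀.IsHaarMeasure] {δ : ↥(archLocal L N H w)} (h : IsStablyConj (starRingEnd ℂ) (H.map w.1.embedding) δ₀ δ) :
    (archLocTorusMeasure H hH h₀ τ₀ δ).IsInvInvariant := by
  haveI := isHaarMeasure_archLocTorusMeasure H hH h₀ τ₀ h
  exact isInvInvariant_of_isHaarMeasure_centralizer_archLocal H δ (isRegularElt_of_isConj h h₀) _

/-- **Local coherence (C_w) under conjugation**: for `δ₁` in the stable class of `δ₀` and `q ∈ U(σ_w H)(ℂ)`, transporting `τ(δ₁)` along the conjugation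
`Z(δ₁) ≃ₜ Z(q δ₁ q⁻¹)` gives `τ(q δ₁ q⁻¹)` (★ FILE 3a cocycle law; `Measure.map_map`). [cite: Shelstad1979, §4 p. 20] [cite: Rogawski1990, §4.3 p. 43] -/
theorem map_subgroupCongrHomeomorph_conj_archLocTorusMeasure (δ₁ δ₂ q : ↥(archLocal L N H w))
    (hq : (MulAut.conj q : _ ≃* ↥(archLocal L N H w)) δ₁ = δ₂) (h₁ : IsStablyConj (starRingEnd ℂ) (H.map w.1.embedding) δ₀ δ₁) :
    Measure.map (subgroupCongrHomeomorph (MulAut.conj q : _ ≃* ↥(archLocal L N H w)) (Subgroup.centralizer ({δ₁} : Set _))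
        (Subgroup.centralizer ({δ₂} : Set _)) (forall_apply_mem_centralizer_singleton_iff_of_eq (MulAut.conj q : _ ≃* _) hq)
        (continuous_mulAutConj q) (continuous_mulAutConj_symm q)) (archLocTorusMeasure H hH h₀ τ₀ δ₁) =
      archLocTorusMeasure H hH h₀ τ₀ δ₂ := by
  have h₂ : IsStablyConj (starRingEnd ℂ) (H.map w.1.embedding) δ₀ δ₂ :=
    isStablyConj_trans_archLocal H h₁ (isStablyConj_archLocal_of_mulAutConj_eq H q hq)
  have hm1 : Measurable ⇑(archLocalStableCentralizerEquiv H hH h₁ h₀) := (archLocalStableCentralizerEquiv H hH h₁ h₀).continuous.measurable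
  have hm2 : Measurable ⇑(subgroupCongrHomeomorph (MulAut.conj q : _ ≃* ↥(archLocal L N H w)) (Subgroup.centralizer ({δ₁} : Set _))
      (Subgroup.centralizer ({δ₂} : Set _)) (forall_apply_mem_centralizer_singleton_iff_of_eq (MulAut.conj q : _ ≃* _) hq)
      (continuous_mulAutConj q) (continuous_mulAutConj_symm q)) := (Homeomorph.continuous _).measurable
  rw [archLocTorusMeasure_eq_map H hH h₀ τ₀ h₁, archLocTorusMeasure_eq_map H hH h₀ τ₀ h₂, Measure.map_map hm2 hm1]
  exact congrArg (fun f => Measure.map f τ₀) (subgroupCongrHomeomorph_conj_comp_archLocalStableCentralizerEquiv H hH h₁ h₀ q hq)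

variable (νw : Measure ↥(archLocal L N H w)) [νw.IsHaarMeasure] [νw.IsMulRightInvariant]
  [∀ δ : ↥(archLocal L N H w), MeasurableSpace (↥(archLocal L N H w) ⧸ Subgroup.centralizer ({δ} : Set ↥(archLocal L N H w)))]
  [∀ δ : ↥(archLocal L N H w), BorelSpace (↥(archLocal L N H w) ⧸ Subgroup.centralizer ({δ} : Set ↥(archLocal L N H w)))]

/-- The Weil quotient `dνw ∕ dτ(δ)` at a point `δ` of the stable class of `δ₀` (★ `quotientMeasure`; the topological instances of `U(σ_w H)(ℂ)` and the Haar ∕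
inversion-invariance instances of `τ(δ)` are supplied inside). [cite: DeitmarEchterhoff2014, Thm. 1.5.3] -/
def archLocWeilPoint [τ₀.IsHaarMeasure] (δ : ↥(archLocal L N H w)) (h : IsStablyConj (starRingEnd ℂ) (H.map w.1.embedding) δ₀ δ) :
    Measure (↥(archLocal L N H w) ⧸ Subgroup.centralizer ({δ} : Set ↥(archLocal L N H w))) := by
  haveI := locallyCompactSpace_archLocal L N H w
  haveI := secondCountableTopology_archLocal L N H w
  haveI := isHaarMeasure_archLocTorusMeasure H hH h₀ τ₀ h
  haveI := isInvInvariant_archLocTorusMeasure H hH h₀ τ₀ h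
  exact quotientMeasure (Subgroup.centralizer ({δ} : Set ↥(archLocal L N H w))) (archLocTorusMeasure H hH h₀ τ₀ δ)
    (isClosed_coe_centralizer_singleton δ) νw

/-- `archLocWeilPoint δ h = dνw ∕ dτ(δ)` for any instance witnesses (definitional). [cite: DeitmarEchterhoff2014, Thm. 1.5.3] -/
theorem archLocWeilPoint_eq [τ₀.IsHaarMeasure] [LocallyCompactSpace ↥(archLocal L N H w)] [SecondCountableTopology ↥(archLocal L N H w)]
    (δ : ↥(archLocal L N H w)) (h : IsStablyConj (starRingEnd ℂ) (H.map w.1.embedding) δ₀ δ)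
    [(archLocTorusMeasure H hH h₀ τ₀ δ).IsHaarMeasure] [(archLocTorusMeasure H hH h₀ τ₀ δ).IsInvInvariant] :
    archLocWeilPoint H hH h₀ τ₀ νw δ h =
      quotientMeasure (Subgroup.centralizer ({δ} : Set ↥(archLocal L N H w))) (archLocTorusMeasure H hH h₀ τ₀ δ)
        (isClosed_coe_centralizer_singleton δ) νw :=
  rfl

/-- **THE LOCAL WEIL FAMILY** of `U(σ_w H)(ℂ)` on the stable class of `δ₀`: `c ↦ dνw ∕ dτ(out c)` (★ `quotientMeasure`, Deitmar–Echterhoff Thm. 1.5.3) when the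
representative `out c` lies in the stable class, junk `0` (invariant, finite on compacta) elsewhere.  [cite: DeitmarEchterhoff2014, Thm. 1.5.3]
[cite: Rogawski1990, §1.7 p. 6; §4.3 (4.3.1) p. 43] -/
def archLocWeilFamily [τ₀.IsHaarMeasure] : OrbitalMeasureFamily ↥(archLocal L N H w) := fun c =>
  if h : IsStablyConj (starRingEnd ℂ) (H.map w.1.embedding) δ₀ (Quotient.out c) then archLocWeilPoint H hH h₀ τ₀ νw (Quotient.out c) h else 0

/-- The local Weil family on the stable class is the Weil quotient at the representative. [cite: DeitmarEchterhoff2014, Thm. 1.5.3] -/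
theorem archLocWeilFamily_of_pos [τ₀.IsHaarMeasure] (c : ConjClasses ↥(archLocal L N H w))
    (h : IsStablyConj (starRingEnd ℂ) (H.map w.1.embedding) δ₀ (Quotient.out c)) :
    archLocWeilFamily H hH h₀ τ₀ νw c = archLocWeilPoint H hH h₀ τ₀ νw (Quotient.out c) h :=
  dif_pos h

/-- The local Weil family off the stable class is the junk `0`. [folklore] -/
theorem archLocWeilFamily_of_not [τ₀.IsHaarMeasure] (c : ConjClasses ↥(archLocal L N H w))
    (h : ¬ IsStablyConj (starRingEnd ℂ) (H.map w.1.embedding) δ₀ (Quotient.out c)) : archLocWeilFamily H hH h₀ τ₀ νw c = 0 :=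
  dif_neg h

/-- **The local Weil family IS in Weil form** (★ `OrbitalMeasureFamily.IsQuotientOf`) for `(νw, τ)` on the stable class of `δ₀` (the topological instance binders on
`U(σ_w H)(ℂ)` are ★ `locallyCompactSpace_archLocal` ∕ ★ `secondCountableTopology_archLocal`, supplied by consumers with `haveI`).
[cite: DeitmarEchterhoff2014, Thm. 1.5.3] [cite: Rogawski1990, §4.3 (4.3.1) p. 43] -/
theorem archLocWeilFamily_isQuotientOf [τ₀.IsHaarMeasure] [LocallyCompactSpace ↥(archLocal L N H w)] [SecondCountableTopology ↥(archLocal L N H w)] :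
    (archLocWeilFamily H hH h₀ τ₀ νw).IsQuotientOf (fun δ : ↥(archLocal L N H w) => IsStablyConj (starRingEnd ℂ) (H.map w.1.embedding) δ₀ δ) νw
      (archLocTorusMeasure H hH h₀ τ₀) := by
  intro c hc
  haveI := isHaarMeasure_archLocTorusMeasure H hH h₀ τ₀ hc
  haveI := isInvInvariant_archLocTorusMeasure H hH h₀ τ₀ hc
  refine ⟨inferInstance, inferInstance, ?_⟩
  rw [archLocWeilFamily_of_pos H hH h₀ τ₀ νw c hc]
  rfl

/-- Every member of the local Weil family is invariant (the quotient measures are; the junk `0` is). [cite: DeitmarEchterhoff2014, Thm. 1.5.3] -/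
theorem smulInvariantMeasure_archLocWeilFamily [τ₀.IsHaarMeasure] (c : ConjClasses ↥(archLocal L N H w)) :
    SMulInvariantMeasure ↥(archLocal L N H w) _ (archLocWeilFamily H hH h₀ τ₀ νw c) := by
  haveI := locallyCompactSpace_archLocal L N H w
  haveI := secondCountableTopology_archLocal L N H w
  by_cases h : IsStablyConj (starRingEnd ℂ) (H.map w.1.embedding) δ₀ (Quotient.out c)
  · obtain ⟨h1, h2, h3⟩ := archLocWeilFamily_isQuotientOf H hH h₀ τ₀ νw c h
    rw [h3]
    exact smulInvariantMeasure_quotientMeasure _ _ _ _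
  · rw [archLocWeilFamily_of_not H hH h₀ τ₀ νw c h]
    infer_instance

/-- Every member of the local Weil family is finite on compacta. [cite: DeitmarEchterhoff2014, Thm. 1.5.3] -/
theorem isFiniteMeasureOnCompacts_archLocWeilFamily [τ₀.IsHaarMeasure] (c : ConjClasses ↥(archLocal L N H w)) :
    IsFiniteMeasureOnCompacts (archLocWeilFamily H hH h₀ τ₀ νw c) := by
  haveI := locallyCompactSpace_archLocal L N H w
  haveI := secondCountableTopology_archLocal L N H w
  by_cases h : IsStablyConj (starRingEnd ℂ) (H.map w.1.embedding) δ₀ (Quotient.out c)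
  · obtain ⟨h1, h2, h3⟩ := archLocWeilFamily_isQuotientOf H hH h₀ τ₀ νw c h
    rw [h3]
    infer_instance
  · rw [archLocWeilFamily_of_not H hH h₀ τ₀ νw c h]
    infer_instance

/-- **The local Weil family READ AT A POINT of the stable class**: `(archLocWeilFamily …).atPoint δ = dνw ∕ dτ(δ)` — Weil form + the conjugation coherence of
`τ` (★ `IsQuotientOf.atPoint_eq_quotientMeasure_of_forall_map_conj_eq`). [cite: DeitmarEchterhoff2014, Thm. 1.5.3] [cite: Rogawski1990, §4.3 (4.3.1) p. 43] -/
theorem archLocWeilFamily_atPoint [τ₀.IsHaarMeasure] [LocallyCompactSpace ↥(archLocal L N H w)] [SecondCountableTopology ↥(archLocal L N H w)]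
    (δ : ↥(archLocal L N H w)) (h : IsStablyConj (starRingEnd ℂ) (H.map w.1.embedding) δ₀ δ) :
    ∃ (_ : (archLocTorusMeasure H hH h₀ τ₀ δ).IsHaarMeasure) (_ : (archLocTorusMeasure H hH h₀ τ₀ δ).IsInvInvariant),
      (archLocWeilFamily H hH h₀ τ₀ νw).atPoint δ =
        quotientMeasure (Subgroup.centralizer ({δ} : Set _)) (archLocTorusMeasure H hH h₀ τ₀ δ) (isClosed_coe_centralizer_singleton δ) νw := by
  exact (archLocWeilFamily_isQuotientOf H hH h₀ τ₀ νw).atPoint_eq_quotientMeasure_of_forall_map_conj_eq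
    (fun (δ₁ q : ↥(archLocal L N H w)) hδ₁ => isStablyConj_trans_archLocal H hδ₁ (isStablyConj_archLocal_of_mulAutConj_eq H q rfl))
    (fun (δ₁ δ₂ q : ↥(archLocal L N H w)) hq hδ₁ => map_subgroupCongrHomeomorph_conj_archLocTorusMeasure H hH h₀ τ₀ δ₁ δ₂ q hq hδ₁) δ h

end HaarLocal

/-! ## §6 The product clause of ★ CARD 3 from T2's (W)(C) -/

section Product

variable {L : Type} [Field L] [NumberField L] [IsCMField L] {N : ℕ} (H : Matrix (Fin N) (Fin N) L) (hH : H.det ≠ 0)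
  [MeasurableSpace ↥(arch (↥(maximalRealSubfield L)) L (IsCMField.complexConj L) N H)]
  [BorelSpace ↥(arch (↥(maximalRealSubfield L)) L (IsCMField.complexConj L) N H)]
  [∀ γ : ↥(arch (↥(maximalRealSubfield L)) L (IsCMField.complexConj L) N H),
    MeasurableSpace (↥(arch (↥(maximalRealSubfield L)) L (IsCMField.complexConj L) N H) ⧸ Subgroup.centralizer ({γ} : Set _))]
  [∀ γ : ↥(arch (↥(maximalRealSubfield L)) L (IsCMField.complexConj L) N H),
    BorelSpace (↥(arch (↥(maximalRealSubfield L)) L (IsCMField.complexConj L) N H) ⧸ Subgroup.centralizer ({γ} : Set _))]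
  [∀ w : {w : InfinitePlace L // w.IsComplex}, MeasurableSpace ↥(archLocal L N H w)]
  [∀ w : {w : InfinitePlace L // w.IsComplex}, BorelSpace ↥(archLocal L N H w)]
  [∀ (w : {w : InfinitePlace L // w.IsComplex}) (δ : ↥(archLocal L N H w)),
    MeasurableSpace (↥(archLocal L N H w) ⧸ Subgroup.centralizer ({δ} : Set ↥(archLocal L N H w)))]
  [∀ (w : {w : InfinitePlace L // w.IsComplex}) (δ : ↥(archLocal L N H w)),
    BorelSpace (↥(archLocal L N H w) ⧸ Subgroup.centralizer ({δ} : Set ↥(archLocal L N H w)))]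

omit
  [∀ γ : ↥(arch (↥(maximalRealSubfield L)) L (IsCMField.complexConj L) N H),
    MeasurableSpace (↥(arch (↥(maximalRealSubfield L)) L (IsCMField.complexConj L) N H) ⧸ Subgroup.centralizer ({γ} : Set _))]
  [∀ γ : ↥(arch (↥(maximalRealSubfield L)) L (IsCMField.complexConj L) N H),
    BorelSpace (↥(arch (↥(maximalRealSubfield L)) L (IsCMField.complexConj L) N H) ⧸ Subgroup.centralizer ({γ} : Set _))]
  [∀ (w : {w : InfinitePlace L // w.IsComplex}) (δ : ↥(archLocal L N H w)),
    MeasurableSpace (↥(archLocal L N H w) ⧸ Subgroup.centralizer ({δ} : Set ↥(archLocal L N H w)))]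
  [∀ (w : {w : InfinitePlace L // w.IsComplex}) (δ : ↥(archLocal L N H w)),
    BorelSpace (↥(archLocal L N H w) ⧸ Subgroup.centralizer ({δ} : Set ↥(archLocal L N H w)))] in
/-- **A Haar measure on `Z(γ)` is a product of local Haar measures along `Z(γ) ≅ ∏_w Z(γ_w)`** (Haar uniqueness on the product, one factor rescaled — ★ CARD 6
`exists_pi_eq_map_of_isHaarMeasure` on ★ FILE 3a `archCentralizerPiEquiv`). [cite: Folland1995, §2.2 Thm. 2.20] -/
theorem exists_pi_eq_map_archCentralizerPiEquiv (γ : ↥(arch (↥(maximalRealSubfield L)) L (IsCMField.complexConj L) N H))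
    (μ : Measure (Subgroup.centralizer ({γ} : Set ↥(arch (↥(maximalRealSubfield L)) L (IsCMField.complexConj L) N H)))) [μ.IsHaarMeasure] :
    ∃ τ₀ : ∀ w : {w : InfinitePlace L // w.IsComplex}, Measure (Subgroup.centralizer ({archPiEquivCM L H (N := N) γ w} : Set ↥(archLocal L N H w))),
      (∀ w, (τ₀ w).IsHaarMeasure) ∧ μ.map (archCentralizerPiEquiv H γ) = Measure.pi τ₀ := by
  haveI : ∀ w : {w : InfinitePlace L // w.IsComplex}, SecondCountableTopology ↥(archLocal L N H w) := fun w =>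
    secondCountableTopology_archLocal L N H w
  haveI : ∀ w : {w : InfinitePlace L // w.IsComplex}, LocallyCompactSpace ↥(archLocal L N H w) := fun w =>
    locallyCompactSpace_archLocal L N H w
  haveI : ∀ w : {w : InfinitePlace L // w.IsComplex},
      LocallyCompactSpace (Subgroup.centralizer ({archPiEquivCM L H (N := N) γ w} : Set ↥(archLocal L N H w))) := fun w =>
    (isClosed_coe_centralizer_singleton _).isClosedEmbedding_subtypeVal.locallyCompactSpace
  haveI : ∀ w : {w : InfinitePlace L // w.IsComplex},
      SecondCountableTopology (Subgroup.centralizer ({archPiEquivCM L H (N := N) γ w} : Set ↥(archLocal L N H w))) := fun w =>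
    TopologicalSpace.Subtype.secondCountableTopology _
  -- a CM field is totally complex, so the index type of complex places is non-empty
  haveI : Nonempty {w : InfinitePlace L // IsComplex w} := ⟨⟨Classical.arbitrary _, IsTotallyComplex.isComplex _⟩⟩
  exact exists_pi_eq_map_of_isHaarMeasure (archCentralizerPiEquiv H γ) μ (fun w => Measure.haar)

omit [MeasurableSpace ↥(arch (↥(maximalRealSubfield L)) L (IsCMField.complexConj L) N H)]
  [BorelSpace ↥(arch (↥(maximalRealSubfield L)) L (IsCMField.complexConj L) N H)]
  [∀ w : {w : InfinitePlace L // w.IsComplex}, MeasurableSpace ↥(archLocal L N H w)]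
  [∀ w : {w : InfinitePlace L // w.IsComplex}, BorelSpace ↥(archLocal L N H w)] in
/-- `archQuotPiEquiv` as two push-forwards: along ★ `cosetCongr e` then along ★ `quotientPiHomeomorph` (definitional unfolding of ★ FILE 2's homeomorphism,
for rewriting with ★ `map_cosetCongr_quotientMeasure` and ★ `map_quotientPiHomeomorph_quotientMeasure_pi`). [folklore] -/
theorem map_archQuotPiEquiv_eq [∀ w : {w : InfinitePlace L // w.IsComplex}, SecondCountableTopology ↥(archLocal L N H w)]
    (γ₀ : ↥(arch (↥(maximalRealSubfield L)) L (IsCMField.complexConj L) N H))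
    [MeasurableSpace ((∀ w : {w : InfinitePlace L // w.IsComplex}, ↥(archLocal L N H w)) ⧸
      Subgroup.pi Set.univ (fun w : {w : InfinitePlace L // w.IsComplex} =>
        Subgroup.centralizer ({archPiEquivCM L H (N := N) γ₀ w} : Set ↥(archLocal L N H w))))]
    [BorelSpace ((∀ w : {w : InfinitePlace L // w.IsComplex}, ↥(archLocal L N H w)) ⧸
      Subgroup.pi Set.univ (fun w : {w : InfinitePlace L // w.IsComplex} =>
        Subgroup.centralizer ({archPiEquivCM L H (N := N) γ₀ w} : Set ↥(archLocal L N H w))))]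
    (μ : Measure (↥(arch (↥(maximalRealSubfield L)) L (IsCMField.complexConj L) N H) ⧸ Subgroup.centralizer ({γ₀} : Set _))) :
    μ.map (archQuotPiEquiv H γ₀) =
      (μ.map (cosetCongr (archPiEquivCM L H (N := N)).toMulEquiv
          (Subgroup.centralizer ({γ₀} : Set ↥(arch (↥(maximalRealSubfield L)) L (IsCMField.complexConj L) N H)))
          (Subgroup.pi Set.univ (fun w : {w : InfinitePlace L // w.IsComplex} =>
            Subgroup.centralizer ({archPiEquivCM L H (N := N) γ₀ w} : Set ↥(archLocal L N H w))))
          (archPiEquivCM_mem_pi_centralizer_iff H γ₀))).map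
        (quotientPiHomeomorph fun w : {w : InfinitePlace L // w.IsComplex} =>
          Subgroup.centralizer ({archPiEquivCM L H (N := N) γ₀ w} : Set ↥(archLocal L N H w))) := by
  have hq : Measurable ⇑(quotientPiHomeomorph fun w : {w : InfinitePlace L // w.IsComplex} =>
      Subgroup.centralizer ({archPiEquivCM L H (N := N) γ₀ w} : Set ↥(archLocal L N H w))) := (Homeomorph.continuous _).measurable
  have hc : Measurable (cosetCongr (archPiEquivCM L H (N := N)).toMulEquiv
      (Subgroup.centralizer ({γ₀} : Set ↥(arch (↥(maximalRealSubfield L)) L (IsCMField.complexConj L) N H)))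
      (Subgroup.pi Set.univ (fun w : {w : InfinitePlace L // w.IsComplex} =>
        Subgroup.centralizer ({archPiEquivCM L H (N := N) γ₀ w} : Set ↥(archLocal L N H w))))
      (archPiEquivCM_mem_pi_centralizer_iff H γ₀)) :=
    (continuous_cosetCongr _ _ _ _ (archPiEquivCM L H (N := N)).continuous).measurable
  rw [Measure.map_map hq hc]
  rfl

end Product

end Summit.HodgeConjecture.HodgeConjecture.R90.S2

end
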